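import Summits.QuantumFields.YangMills.Theorems.PencilRigidityWeakCouplingHypercubicLimitRPDiagClusterTransportPrep
import HarnessLib

/-!
# Crux `WeakCouplingHypercubicLimitRP` (stmt-QuantumFields-27398), line `Sketch`, door B, R1-side:
# the polarisation transport `RPSpectral → DiagCluster`

Helper file (`--supports stmt-QuantumFields-27398 --as helper`) of the crux lead `lead-27398-D1` g3 (docket director-ym g24,
O4 WORD 37 internal plan (p1) of the registered stub D1′ `stub_oddTorusSwapPairingLiminf` of
`Cruxes/WeakCouplingHypercubicLimitRP/Lines/Sketch.lean`, skeleton ρ1 v2 `97b02a6fc0a363ac`; critic idea-crit-9 g13, verdict #115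
PASS-WITH-PRICE).  It proves the FIRST LEMMA of idea card
`Cruxes/WeakCouplingHypercubicLimitRP/Ideas/axis-diagonal-polarisation-transport.md` (cruxidea-10604-r2 seat `spectral-transfer`):

  `diagCluster_of_rpSpectral : 0 ≤ Δ → 0 ≤ C → (∀ᶠ k, 0 ≤ β_k) → RPSpectral r sch Δ C → DiagCluster r sch Δ C`

— the AXIS letter `RPSpectral` (✓ `…MirrorModularBoostsHypercubicLimitClosureHalvesDefs`, relative clustering of reflected
axis-slab functionals at rate `Δ a_k` per lattice time step, thermal floor `C B² e^{−Δ a_k S}`) implies relative clustering ALONG THE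
DIAGONAL `d = e₀ − e₁` with the SWAP mirror for box-local functionals (`DiagCluster`, ✓ `…DiagonalMirrorRPRDiagClusterDefs`,
verbatim Sketch §2 of the card), with the SAME constants `(Δ, C)`.

Mechanism (soft; measure-preserving bookkeeping + one reflection-positivity Cauchy–Schwarz; §1–§4 are the companion file
`…PencilRigidityWeakCouplingHypercubicLimitRPDiagClusterTransportPrep`, §5 is this file):
* §1 `ℤ⁴` geometry: the swap image `Y ∘ Σ` is `Y_B ∘ τ⁻¹ ∘ Θ` with `Y_B := Y ∘ Σ ∘ Θ ∘ τ` (`Θ = gaugeTimeReflect`, the bond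
  reflection in `x₀ = −1/2`; `τᶜ = configShift (−c e₀)`), the diagonal shift splits `configShift (−n e₀ + n e₁) = configShift (n e₁) ∘ τⁿ`,
  and the periodic lift of the torus reflection is `torusLift (Θ_T U) = τ⁻² Θ (torusLift U)` (pointwise);
* §2 supports: `Y_A := Y ∘ configShift (n e₁)` and `Y_B` are axis-slab-local in `{1 ≤ x₀ ≤ T}` when `Y` is `diagBox T`-local (the slab
  constrains `x₀` only — «one diagonal step advances `x₀` by one unit»), and shifted lifts `Z ∘ τᵇ ∘ torusLift` of slab-local `Z`
  are positive-half observables (`oPosEdges`) of the odd torus `2S+1` when `T + b ≤ S`;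
* §3 invariance of Wilson's torus state under `Σ`, `Θ`, translations along the lift (`integral_comp_configPerm_wilsonMeasure`,
  `rpShift_integral_gaugeTimeReflect_torusLift`, `rpShift_integral_configShift_torusLift`, `rpShift_integral_shift_pair`): means and
  second moments of `Y_A`, `Y_B` are those of `Y`; the diagonal value of the reflection form on `Z ∘ τᵇ ∘ lift` is the axis pairing
  of `Z` at shift `2b`;
* §4 reflection positivity on the odd torus (`integral_mul_timeReflect_nonneg_odd`): `(∫ A)² ≤ ∫ A · A∘Θ_T`, and `∫ Z(Θ_T ·)·Z ≤ ∫ Z²`;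
* §5 the transport: with the BALANCED shifts `b_A = ⌈n/2⌉`, `b_B = ⌊n/2⌋ + 1` (`b_A + b_B = n + 1`) the swap-paired diagonally
  shifted expectation is `∫ A · B_f∘Θ_T` for `A = Y_A ∘ τ^{b_A} ∘ lift`, `B_f = Y_B ∘ τ^{b_B} ∘ lift`; `sq_cov_timeReflect_le_odd`
  (Fröhlich–Israel–Lieb–Simon Thm 2.1) gives `q² ≤ p_A p_B`; `RPSpectral` at shifts `2b_A, 2b_B ∈ {n, n+1, n+2}` (room
  `2(T + 2b + 1) ≤ 2(2T+n+3) ≤ S`) bounds `p_A, p_B ≤ e^{−Δ a_k n} Var Y + C B² e^{−Δ a_k S}` (shift-0 pairing in `[0, Var]`), and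
  `abs_le_of_sq_le_mul_of_le` — no cross term.

HONEST FRAMING: a soft transport between two LETTERS; it proves neither `RPSpectral` nor `DiagCluster` for Wilson's model, and
`DiagCluster` is a clustering INEQUALITY (never a positivity of the swap pairing, which fails at every finite `k`).  The stub D1′,
the crux ⟨27398⟩, its heart S6i and the summit are OPEN; the Yang–Mills mass gap is NOT proved here or anywhere in the tree.

References: Osterwalder–Seiler, Ann. Phys. 110 (1978) §2; Fröhlich–Israel–Lieb–Simon, CMP 62 (1978) Thm 2.1; Glimm–Jaffe (1987)
§6.1; Seiler, LNP 159 (1982) Ch. 2.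
-/

set_option autoImplicit false

noncomputable section

open MeasureTheory Filter Topology
open Literature.MathematicalPhysics.QuantumLattice Literature.MathematicalPhysics.AQFT
  Literature.MathematicalPhysics.QuantumFieldTheory
open Literature.MathematicalPhysics.QuantumFieldTheory.WilsonOddRP (oPosEdges oSharedEdges IsOPosEdge mem_oPosEdges)
open Summit.QuantumFields.YangMills.Cruxes.HypercubicLimit.CouplingResponse (RPSpectral)
open Summit.QuantumFields.YangMills.Theorems.ContinuumLegGivenGap
open Summit.QuantumFields.YangMills.Theorems.ClusteringToYangMills.Reconstructible
  (gaugeTimeReflect_gaugeTimeReflect measurable_gaugeTimeReflect)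
open Summit.QuantumFields.YangMills.Cruxes.NT.Reflection
  (sq_cov_timeReflect_le_odd integral_mul_timeReflect_nonneg_odd integral_centred_mul_timeReflect
    integrable_wilson_of_bdd)

namespace Summit.QuantumFields.YangMills.Cruxes.DiagonalMirrorRPR.SpectralTransfer


/-! ## §5 The transport `RPSpectral → DiagCluster` -/

section Transport

variable {G : Type} [Group G] [TopologicalSpace G] [IsTopologicalGroup G] [CompactSpace G]
  [MeasurableSpace G] [BorelSpace G]

/-- The arithmetic heart of the transport: if `q² ≤ p·s` with `0 ≤ p, s ≤ b` then `|q| ≤ b` — no cross term.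
[folklore] -/
theorem abs_le_of_sq_le_mul_of_le {p q s b : ℝ} (hp : 0 ≤ p) (hs : 0 ≤ s) (hcs : q ^ 2 ≤ p * s)
    (hpb : p ≤ b) (hsb : s ≤ b) : |q| ≤ b := by
  have hb : 0 ≤ b := hp.trans hpb
  have hq : q ^ 2 ≤ b ^ 2 := hcs.trans (by nlinarith [mul_le_mul hpb hsb hs hb])
  exact abs_le_of_sq_le_sq hq hb

/-- **The polarisation transport (first lemma of idea card `axis-diagonal-polarisation-transport`, door B R1-side of
crux ⟨stmt-QuantumFields-27398⟩).**  From the AXIS letter `RPSpectral r sch Δ C` (`0 ≤ Δ`, Wilson weight `β_k ≥ 0`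
eventually) the DIAGONAL clustering `DiagCluster r sch Δ C` with the SAME constants.  Proof: write the swap-paired, diagonally
shifted expectation as the value `∫ A · B_f∘Θ_T` of the bond-reflection form of the odd torus on the shifted lifts
`A = Y_A ∘ τ^{⌈n/2⌉} ∘ lift`, `B_f = Y_B ∘ τ^{⌊n/2⌋+1} ∘ lift` of the axis-slab-local functionals `Y_A = Y ∘ configShift (n e₁)`,
`Y_B = Y ∘ Σ ∘ Θ ∘ τ` (swap, reflections and translations preserve Wilson's torus state); reflection-positivity Cauchy–Schwarz
(`sq_cov_timeReflect_le_odd`) bounds its square by the product of the two diagonal values, which are the axis pairings of `Y_A`,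
`Y_B` at shifts `2⌈n/2⌉, 2⌊n/2⌋+2 ≥ n`; `RPSpectral` bounds each by `e^{−Δ a_k n}·Var Y + C B² e^{−Δ a_k S}` (the reflection
pairing at shift `0` lies in `[0, Var]`, `Var Y_A = Var Y_B = Var Y`), and no cross term appears (`abs_le_of_sq_le_mul_of_le`).
[cite: FrohlichIsraelLiebSimon1978, Thm. 2.1] -/
theorem diagCluster_of_rpSpectral (r : LatticeRep G) (sch : SpeciesScheme (YMSpecies G)) (Δ C : ℝ)
    (hΔ : 0 ≤ Δ) (_hC : 0 ≤ C) (hβ : ∀ᶠ k in atTop, 0 ≤ sch.β k) :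
    RPSpectral r sch Δ C → DiagCluster r sch Δ C := by
  intro hRP
  unfold DiagCluster
  unfold RPSpectral at hRP
  filter_upwards [hRP, hβ] with k hk hβk
  clear hRP
  intro S T n hL hroom Y B hYm hYb hYdep
  have hS1 : 1 ≤ S := by omega
  have hodd : Odd (2 * S + 1) := ⟨S, rfl⟩
  have h3 : 3 ≤ 2 * S + 1 := by omega
  have hρ := r.continuous
  haveI : IsProbabilityMeasure (wilsonMeasure r.ρ (sch.β k) : Measure (GaugeConfig 4 (2 * S + 1) G)) :=
    isProbabilityMeasure_wilsonMeasure (d := 4) (L := 2 * S + 1) r.ρ hρ _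
  -- the balanced shifts
  obtain ⟨bA, hbA⟩ : ∃ bA : ℕ, bA = n - n / 2 := ⟨_, rfl⟩
  obtain ⟨bB, hbB⟩ : ∃ bB : ℕ, bB = n / 2 + 1 := ⟨_, rfl⟩
  have hAB : bA + bB = n + 1 := by omega
  have hbA2 : n ≤ 2 * bA ∧ 2 * bA ≤ n + 1 := by omega
  have hbB2 : n ≤ 2 * bB ∧ 2 * bB ≤ n + 2 := by omega
  -- the two axis-slab-local functionals
  obtain ⟨YA, hYA⟩ : ∃ YA : LGConfig 4 G → ℝ, YA = fun W => Y (configShift (Pi.single 1 (n : ℤ)) W) := ⟨_, rfl⟩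
  obtain ⟨YB, hYB⟩ : ∃ YB : LGConfig 4 G → ℝ, YB = fun W => Y (configPermZd (Equiv.swap (0 : Fin 4) 1)
    (gaugeTimeReflect (configShift (-Pi.single 0 (1 : ℤ)) W))) := ⟨_, rfl⟩
  have hYAm : Measurable YA := by rw [hYA]; exact hYm.comp (configShift _).measurable
  have hYBm : Measurable YB := by
    rw [hYB]
    exact hYm.comp ((configPermZd _).measurable.comp (measurable_gaugeTimeReflect.comp (configShift _).measurable))
  have hYAb : ∀ W, |YA W| ≤ B := fun W => by rw [hYA]; exact hYb _
  have hYBb : ∀ W, |YB W| ≤ B := fun W => by rw [hYB]; exact hYb _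
  have hYAdep : DependsOn YA {e : Literature.MathematicalPhysics.QuantumLattice.ZdEdge 4 |
      1 ≤ e.1 0 ∧ e.1 0 + (if e.2 = 0 then 1 else 0) ≤ T} := by
    rw [hYA]; exact dependsOn_shiftOne hYdep n
  have hYBdep : DependsOn YB {e : Literature.MathematicalPhysics.QuantumLattice.ZdEdge 4 |
      1 ≤ e.1 0 ∧ e.1 0 + (if e.2 = 0 then 1 else 0) ≤ T} := by
    rw [hYB]; exact dependsOn_swapReflectShift hYdep
  -- `RPSpectral` at the doubled balanced shifts
  have hRA := hk S T (2 * bA) hL (by omega) YA B hYAm hYAb hYAdep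
  have hRB := hk S T (2 * bB) hL (by omega) YB B hYBm hYBb hYBdep
  clear hk
  -- the shifted lifts: positive-half observables of the odd torus
  obtain ⟨A, hA⟩ : ∃ A : GaugeConfig 4 (2 * S + 1) G → ℝ,
      A = fun U => YA (configShift (-Pi.single 0 (bA : ℤ)) (torusLift (2 * S + 1) U)) := ⟨_, rfl⟩
  obtain ⟨Bf, hBf⟩ : ∃ Bf : GaugeConfig 4 (2 * S + 1) G → ℝ,
      Bf = fun U => YB (configShift (-Pi.single 0 (bB : ℤ)) (torusLift (2 * S + 1) U)) := ⟨_, rfl⟩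
  have hAm : Measurable A := by
    rw [hA]; exact hYAm.comp ((configShift _).measurable.comp (measurable_torusLift _))
  have hBm : Measurable Bf := by
    rw [hBf]; exact hYBm.comp ((configShift _).measurable.comp (measurable_torusLift _))
  have hAb : ∃ K : ℝ, ∀ U, |A U| ≤ K := ⟨B, fun U => by rw [hA]; exact hYAb _⟩
  have hBb : ∃ K : ℝ, ∀ U, |Bf U| ≤ K := ⟨B, fun U => by rw [hBf]; exact hYBb _⟩
  have hAdep : DependsOn A ((oPosEdges ∪ oSharedEdges : Finset (Edge 4 (2 * S + 1))) : Set (Edge 4 (2 * S + 1))) := by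
    rw [hA]; exact dependsOn_shift_torusLift (S := S) (b := bA) hYAdep (by omega)
  have hBdep : DependsOn Bf ((oPosEdges ∪ oSharedEdges : Finset (Edge 4 (2 * S + 1))) : Set (Edge 4 (2 * S + 1))) := by
    rw [hBf]; exact dependsOn_shift_torusLift (S := S) (b := bB) hYBdep (by omega)
  -- means and second moments
  have hYA_mean : ∫ U, YA (torusLift (2 * S + 1) U) ∂(wilsonMeasure r.ρ (sch.β k)) =
      ∫ U, Y (torusLift (2 * S + 1) U) ∂(wilsonMeasure r.ρ (sch.β k)) := by
    simp only [hYA]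
    exact rpShift_integral_configShift_torusLift r.ρ (sch.β k) (2 * S + 1) (Pi.single 1 (n : ℤ)) Y
  have hYA_sq : ∫ U, (YA (torusLift (2 * S + 1) U)) ^ 2 ∂(wilsonMeasure r.ρ (sch.β k)) =
      ∫ U, (Y (torusLift (2 * S + 1) U)) ^ 2 ∂(wilsonMeasure r.ρ (sch.β k)) := by
    simp only [hYA]
    exact rpShift_integral_configShift_torusLift r.ρ (sch.β k) (2 * S + 1) (Pi.single 1 (n : ℤ)) (fun W => (Y W) ^ 2)
  have hYB_mean : ∫ U, YB (torusLift (2 * S + 1) U) ∂(wilsonMeasure r.ρ (sch.β k)) =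
      ∫ U, Y (torusLift (2 * S + 1) U) ∂(wilsonMeasure r.ρ (sch.β k)) := by
    simp only [hYB]
    exact integral_swapReflectShift_torusLift r.ρ hρ (sch.β k) (2 * S + 1) Y
  have hYB_sq : ∫ U, (YB (torusLift (2 * S + 1) U)) ^ 2 ∂(wilsonMeasure r.ρ (sch.β k)) =
      ∫ U, (Y (torusLift (2 * S + 1) U)) ^ 2 ∂(wilsonMeasure r.ρ (sch.β k)) := by
    simp only [hYB]
    exact integral_swapReflectShift_torusLift r.ρ hρ (sch.β k) (2 * S + 1) (fun W => (Y W) ^ 2)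
  have hA_mean : ∫ U, A U ∂(wilsonMeasure r.ρ (sch.β k)) =
      ∫ U, Y (torusLift (2 * S + 1) U) ∂(wilsonMeasure r.ρ (sch.β k)) := by
    simp only [hA]
    rw [rpShift_integral_configShift_torusLift r.ρ (sch.β k) (2 * S + 1) (-Pi.single 0 (bA : ℤ)) YA, hYA_mean]
  have hB_mean : ∫ U, Bf U ∂(wilsonMeasure r.ρ (sch.β k)) =
      ∫ U, Y (torusLift (2 * S + 1) U) ∂(wilsonMeasure r.ρ (sch.β k)) := by
    simp only [hBf]
    rw [rpShift_integral_configShift_torusLift r.ρ (sch.β k) (2 * S + 1) (-Pi.single 0 (bB : ℤ)) YB, hYB_mean]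
  -- the cross term IS the swap-paired diagonally shifted expectation
  have hcross : ∫ U, A U * Bf U.timeReflect ∂(wilsonMeasure r.ρ (sch.β k)) =
      ∫ U, Y (torusLift (2 * S + 1) (configPerm (Equiv.swap (0 : Fin 4) 1) U)) *
        Y (configShift (-Pi.single 0 (n : ℤ) + Pi.single 1 (n : ℤ)) (torusLift (2 * S + 1) U))
          ∂(wilsonMeasure r.ρ (sch.β k)) := by
    have h1 := rpShift_integral_shift_pair r.ρ (sch.β k) (2 * S + 1) YB YA ((bB : ℤ) - 2) (bA : ℤ)
    have h2 := rpShift_integral_shift_pair r.ρ (sch.β k) (2 * S + 1) YB YA (-1 : ℤ) (n : ℤ)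
    have h12 : ((bB : ℤ) - 2) + (bA : ℤ) = -1 + (n : ℤ) := by omega
    rw [h12, ← h2] at h1
    calc ∫ U, A U * Bf U.timeReflect ∂(wilsonMeasure r.ρ (sch.β k))
        = ∫ U, YB (configShift (-Pi.single 0 ((bB : ℤ) - 2)) (gaugeTimeReflect (torusLift (2 * S + 1) U))) *
            YA (configShift (-Pi.single 0 (bA : ℤ)) (torusLift (2 * S + 1) U)) ∂(wilsonMeasure r.ρ (sch.β k)) := by
          refine integral_congr_ae (ae_of_all _ fun U => ?_)
          simp only [hA, hBf]
          rw [configShift_torusLift_timeReflect, mul_comm]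
      _ = ∫ U, YB (configShift (-Pi.single 0 (-1 : ℤ)) (gaugeTimeReflect (torusLift (2 * S + 1) U))) *
            YA (configShift (-Pi.single 0 (n : ℤ)) (torusLift (2 * S + 1) U)) ∂(wilsonMeasure r.ρ (sch.β k)) := h1
      _ = _ := by
          refine integral_congr_ae (ae_of_all _ fun U => ?_)
          simp only [hYA, hYB]
          rw [← swap_eq_swapReflect_unshift Y, ← configShift_diag_split, configPermZd_torusLift]
  -- the diagonal values are the axis pairings at the doubled shifts
  have hdiagA : ∫ U, A U * A U.timeReflect ∂(wilsonMeasure r.ρ (sch.β k)) =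
      ∫ U, YA (torusLift (2 * S + 1) U.timeReflect) *
        YA (configShift (-Pi.single 0 ((2 * bA : ℕ) : ℤ)) (torusLift (2 * S + 1) U)) ∂(wilsonMeasure r.ρ (sch.β k)) := by
    simp only [hA]
    exact integral_shift_mul_shift_timeReflect r.ρ (sch.β k) (2 * S + 1) YA bA
  have hdiagB : ∫ U, Bf U * Bf U.timeReflect ∂(wilsonMeasure r.ρ (sch.β k)) =
      ∫ U, YB (torusLift (2 * S + 1) U.timeReflect) *
        YB (configShift (-Pi.single 0 ((2 * bB : ℕ) : ℤ)) (torusLift (2 * S + 1) U)) ∂(wilsonMeasure r.ρ (sch.β k)) := by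
    simp only [hBf]
    exact integral_shift_mul_shift_timeReflect r.ρ (sch.β k) (2 * S + 1) YB bB
  rw [hYA_mean] at hRA
  rw [hYB_mean] at hRB
  -- the shift-0 reflection pairings lie in `[ (mean)², second moment ]`
  have hP0A_nonneg : (∫ U, Y (torusLift (2 * S + 1) U) ∂(wilsonMeasure r.ρ (sch.β k))) ^ 2 ≤
      ∫ U, YA (torusLift (2 * S + 1) U.timeReflect) * YA (torusLift (2 * S + 1) U) ∂(wilsonMeasure r.ρ (sch.β k)) := by
    have h := sq_integral_le_integral_mul_timeReflect r.ρ hS1 hρ hβk (A := fun U => YA (torusLift (2 * S + 1) U))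
      (hYAm.comp (measurable_torusLift _)) ⟨B, fun U => hYAb _⟩ (dependsOn_torusLift (S := S) hYAdep (by omega))
    rw [hYA_mean] at h
    refine h.trans (le_of_eq (integral_congr_ae (ae_of_all _ fun U => ?_)))
    simp only
    ring
  have hP0B_nonneg : (∫ U, Y (torusLift (2 * S + 1) U) ∂(wilsonMeasure r.ρ (sch.β k))) ^ 2 ≤
      ∫ U, YB (torusLift (2 * S + 1) U.timeReflect) * YB (torusLift (2 * S + 1) U) ∂(wilsonMeasure r.ρ (sch.β k)) := by
    have h := sq_integral_le_integral_mul_timeReflect r.ρ hS1 hρ hβk (A := fun U => YB (torusLift (2 * S + 1) U))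
      (hYBm.comp (measurable_torusLift _)) ⟨B, fun U => hYBb _⟩ (dependsOn_torusLift (S := S) hYBdep (by omega))
    rw [hYB_mean] at h
    refine h.trans (le_of_eq (integral_congr_ae (ae_of_all _ fun U => ?_)))
    simp only
    ring
  have hP0A_le : ∫ U, YA (torusLift (2 * S + 1) U.timeReflect) * YA (torusLift (2 * S + 1) U)
      ∂(wilsonMeasure r.ρ (sch.β k)) ≤ ∫ U, (Y (torusLift (2 * S + 1) U)) ^ 2 ∂(wilsonMeasure r.ρ (sch.β k)) := by
    rw [← hYA_sq]; exact integral_timeReflect_mul_le_sq r.ρ hρ (sch.β k) (2 * S + 1) hYAm hYAb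
  have hP0B_le : ∫ U, YB (torusLift (2 * S + 1) U.timeReflect) * YB (torusLift (2 * S + 1) U)
      ∂(wilsonMeasure r.ρ (sch.β k)) ≤ ∫ U, (Y (torusLift (2 * S + 1) U)) ^ 2 ∂(wilsonMeasure r.ρ (sch.β k)) := by
    rw [← hYB_sq]; exact integral_timeReflect_mul_le_sq r.ρ hρ (sch.β k) (2 * S + 1) hYBm hYBb
  -- positivity of the diagonal values
  have hpA : (∫ U, Y (torusLift (2 * S + 1) U) ∂(wilsonMeasure r.ρ (sch.β k))) ^ 2 ≤
      ∫ U, A U * A U.timeReflect ∂(wilsonMeasure r.ρ (sch.β k)) := by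
    have h := sq_integral_le_integral_mul_timeReflect r.ρ hS1 hρ hβk hAm hAb hAdep
    rwa [hA_mean] at h
  have hpB : (∫ U, Y (torusLift (2 * S + 1) U) ∂(wilsonMeasure r.ρ (sch.β k))) ^ 2 ≤
      ∫ U, Bf U * Bf U.timeReflect ∂(wilsonMeasure r.ρ (sch.β k)) := by
    have h := sq_integral_le_integral_mul_timeReflect r.ρ hS1 hρ hβk hBm hBb hBdep
    rwa [hB_mean] at h
  -- Cauchy–Schwarz of the reflection form
  have hcs := sq_cov_timeReflect_le_odd r.ρ hodd h3 hρ hβk hAm hBm hAb hBb hAdep hBdep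
  rw [hA_mean, hB_mean, hcross, hdiagA, hdiagB, ← sq] at hcs
  rw [hdiagA] at hpA
  rw [hdiagB] at hpB
  -- exponent comparison
  have ha0 : 0 ≤ Δ * sch.a k := mul_nonneg hΔ (sch.a_pos k).le
  have hexpA : Real.exp (-(Δ * sch.a k * ((2 * bA : ℕ) : ℝ))) ≤ Real.exp (-(Δ * sch.a k * n)) := by
    rw [Real.exp_le_exp]
    have : (n : ℝ) ≤ ((2 * bA : ℕ) : ℝ) := by exact_mod_cast hbA2.1
    nlinarith
  have hexpB : Real.exp (-(Δ * sch.a k * ((2 * bB : ℕ) : ℝ))) ≤ Real.exp (-(Δ * sch.a k * n)) := by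
    rw [Real.exp_le_exp]
    have : (n : ℝ) ≤ ((2 * bB : ℕ) : ℝ) := by exact_mod_cast hbB2.1
    nlinarith
  have hgn : 0 ≤ Real.exp (-(Δ * sch.a k * n)) := (Real.exp_pos _).le
  -- the common bound of the two diagonal values, and no cross term
  have hpA_le := (abs_le.1 hRA).2
  have hpB_le := (abs_le.1 hRB).2
  have h1A := (mul_le_mul_of_nonneg_right hexpA (sub_nonneg.2 hP0A_nonneg)).trans
    (mul_le_mul_of_nonneg_left (sub_le_sub_right hP0A_le _) hgn)
  have h1B := (mul_le_mul_of_nonneg_right hexpB (sub_nonneg.2 hP0B_nonneg)).trans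
    (mul_le_mul_of_nonneg_left (sub_le_sub_right hP0B_le _) hgn)
  exact abs_le_of_sq_le_mul_of_le (sub_nonneg.2 hpA) (sub_nonneg.2 hpB) hcs (by linarith) (by linarith)

end Transport

end Summit.QuantumFields.YangMills.Cruxes.DiagonalMirrorRPR.SpectralTransfer

end
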